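import Summits.BirchSwinnertonDyer.BirchSwinnertonDyer.Theorems.ByReductionTypeAtTwoRankOneAtTwoOneDoorFirstDescentDefs
import Summits.BirchSwinnertonDyer.BirchSwinnertonDyer.Theorems.ByReductionTypeAtTwoRankOneAtTwoBigImageOddLocalOneDoorBottomReciprocity
import Summits.BirchSwinnertonDyer.BirchSwinnertonDyer.Theorems.GenusKolyvaginAtTwoEquivariantKolyvaginExactAtTwoTwinGrossPrimes
import HarnessLib

/-!
# Route ByReductionTypeAtTwo, crux `RankOneAtTwoBigImageOddLocal` (stmt-BirchSwinnertonDyer-23715), LINE v8.9 `one_door_analytic`: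
# the fields `rec₁` / `rec₂` of `FirstDescentInput` at `Δ_W < 0`, in the record's currency (ADAPTERS over the width seat's leaves)

Lead prover seat `bsd-line-fkl-p1` g12 (2026-08-28), `--supports stmt-BirchSwinnertonDyer-23715` (helper).  THEOREMS ONLY; no
definition, no named fact introduced, no `sorry`; BSD is not proved by any of this.

Thin ADAPTERS.  The width seat fkl-p2 g10's `Theorems/…OneDoorBottomReciprocity.lean` proves the reciprocity leaf of the bottom rung in
the currency `Place ℚ = InfinitePlace ℚ ⊕ HeightOneSpectrum (𝓞 ℚ)` / `selmerLocalKer W (Place.Completion w) ((2 : ℕ) : ℤ)`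
(`hrec_at_of_card`: Poitou–Tate with one error place + Tate local duality from the count `#E(ℚ_v)[2] = 2`).  The record
`FirstDescentInput W Wd` (`Theorems/…OneDoorFirstDescentDefs.lean`, p641630) indexes local conditions by
`RatPlace = HeightOneSpectrum (𝓞 ℚ) ⊕ InfinitePlace ℚ` with `locAt`/`strictAt` at level `(2 : ℤ)`.  This file re-indexes:

* `rec_of_card_two` — for ANY `X/ℚ` elliptic with `#X(ℚ_v)[2] = 2` at an odd place `v` and a finite `v₀ ≠ v`: the field shape
  `∀ d, (∀ w ≠ pl ℓ, w ≠ q₀ → d ∈ locAt X 2 w) → d ∉ locAt X 2 (pl ℓ) → ∀ s, (∀ w ≠ q₀ → s ∈ locAt X 2 w) → s ∉ strictAt X 2 (pl ℓ) →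
  s ∉ strictAt X 2 q₀` with `pl ℓ = Sum.inl v`, `q₀ = Sum.inl v₀`;
* `rec₁_of_frobEqFrobInfty` — the field `rec₁` for `W` (globally minimal, `Δ_W < 0`) at a Gross–Kolyvagin prime of `(W, K)` at `M = 1`
  (count `ReductionCyclic.natCard_ker_zsmul_adicCompletion_two_pow_eq`, route GenusKolyvaginAtTwo);
* `rec₂_of_frobEqFrobInfty` — the field `rec₂` for a globally minimal model `Wd` of `W^{(d_K)}` at the same primes (count
  `TwinGrossPrimes.natCard_ker_zsmul_adicCompletion_two_pow_eq_twin`).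
(The `line` fields in this currency are the width seat's `line_inl_of_card` / `line₁_inl`, `Theorems/…OneDoorBottomLeavesLines.lean`.)

References: [McCallumLMS1991] §5 Lemma 5.3, §2 Prop. 2.2; [GrossLMS1991] §3 (3.3), Prop. 8.2, §10; [Kolyvagin1989Izv] §3.
-/

set_option autoImplicit false
-- the Theorems namespace of this sub repeats the summit name by design (D-0017 nested layout)
set_option linter.dupNamespace false

noncomputable section

open scoped Classical

namespace Summit.BirchSwinnertonDyer.BirchSwinnertonDyer.Theorems.RankOneAtTwoOneDoor

open WeierstrassCurve NumberField IsDedekindDomain Field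
open Literature.NumberTheory.EllipticCurves Literature.NumberTheory.GaloisRepresentations
open Summit.BirchSwinnertonDyer.Rank1Residual.X11b
open Summit.BirchSwinnertonDyer.BirchSwinnertonDyer.Theorems.GenusExact
open Summit.BirchSwinnertonDyer.BirchSwinnertonDyer.Theorems.GenusExact.FrobeniusCriterion

/-- **The reciprocity field shape from the local count `#X(ℚ_v)[2] = 2`** (any `X/ℚ` elliptic, `ℓ` an odd prime below `v`, `v₀ ≠ v`
finite), in the currency of `FirstDescentInput` with `pl ℓ = Sum.inl v`, `q₀ = Sum.inl v₀`; re-indexing of the width seat's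
`hrec_at_of_card`. [cite: McCallumLMS1991, §5 Lemma 5.3 and §2 Prop. 2.2] [cite: GrossLMS1991, §10 (Claim 10.1)] -/
theorem rec_of_card_two (X : WeierstrassCurve ℚ) [X.IsElliptic] {ℓ : ℕ} [Fact ℓ.Prime] (hℓ2 : ℓ ≠ 2)
    {v v₀ : HeightOneSpectrum (𝓞 ℚ)} (hℓv : (ℓ : 𝓞 ℚ) ∈ v.asIdeal) (hv₀ : v₀ ≠ v)
    (hcard : Nat.card (nsmulAddMonoidHom 2 : (X.baseChange (v.adicCompletion ℚ)).toAffine.Point →+ _).ker = 2)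
    (d : galH1Torsion X 2) (hd : ∀ w : RatPlace, w ≠ Sum.inl v → w ≠ Sum.inl v₀ → d ∈ locAt X 2 w)
    (hdv : d ∉ locAt X 2 (Sum.inl v)) (s : galH1Torsion X 2) (hs : ∀ w : RatPlace, w ≠ Sum.inl v₀ → s ∈ locAt X 2 w)
    (hsv : s ∉ strictAt X 2 (Sum.inl v)) : s ∉ strictAt X 2 (Sum.inl v₀) := by
  have hd' : ∀ w : Place ℚ, w ≠ Sum.inr v → w ≠ Sum.inr v₀ → d ∈ selmerLocalKer X (Place.Completion w) ((2 : ℕ) : ℤ) := by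
    rintro (w | w) hw hw₀
    · exact hd (Sum.inr w) Sum.inr_ne_inl Sum.inr_ne_inl
    · exact hd (Sum.inl w) (fun h => hw (by rw [Sum.inl_injective h])) (fun h => hw₀ (by rw [Sum.inl_injective h]))
  have hs' : ∀ w : Place ℚ, w ≠ Sum.inr v₀ → s ∈ selmerLocalKer X (Place.Completion w) ((2 : ℕ) : ℤ) := by
    rintro (w | w) hw₀
    · exact hs (Sum.inr w) Sum.inr_ne_inl
    · exact hs (Sum.inl w) (fun h => hw₀ (by rw [Sum.inl_injective h]))
  exact hrec_at_of_card X hℓ2 hℓv hcard v₀ hv₀ d hd' hdv s hs' hsv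

/-- **Field `rec₁` at `Δ_W < 0`**: `W/ℚ` globally minimal with `Δ_W < 0`, `ℓ` an odd prime of good reduction below `v` which is a
Gross–Kolyvagin prime of `(W, K)` at `M = 1` (`Frob_ℓ ∼ Frob_∞` on the `2`-division tower, Kolyvagin index `≥ 1`), `v₀ ≠ v` finite:
the E-side reciprocity leaf with `pl ℓ = Sum.inl v`, `q₀ = Sum.inl v₀` (the width seat's `hrec_at`, re-indexed).
[cite: McCallumLMS1991, §5 Lemma 5.3] [cite: GrossLMS1991, §3 (3.3) and §10] -/
theorem rec₁_of_frobEqFrobInfty (W : WeierstrassCurve ℚ) [W.IsElliptic] [W.IsGloballyMinimal] (hΔ : W.Δ < 0)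
    {K : Type} [Field K] [NumberField K] {ℓ : ℕ} [Fact ℓ.Prime] (hℓ2 : ℓ ≠ 2) (hgood : W.HasGoodReductionAtPrime ℓ)
    (hℓK : FrobEqFrobInfty W K 2 ℓ) (hidx : 1 ≤ Zhang2014.kolyvaginIndex W 2 ℓ)
    {v v₀ : HeightOneSpectrum (𝓞 ℚ)} (hℓv : (ℓ : 𝓞 ℚ) ∈ v.asIdeal) (hv₀ : v₀ ≠ v)
    (d : galH1Torsion W 2) (hd : ∀ w : RatPlace, w ≠ Sum.inl v → w ≠ Sum.inl v₀ → d ∈ locAt W 2 w)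
    (hdv : d ∉ locAt W 2 (Sum.inl v)) (s : galH1Torsion W 2) (hs : ∀ w : RatPlace, w ≠ Sum.inl v₀ → s ∈ locAt W 2 w)
    (hsv : s ∉ strictAt W 2 (Sum.inl v)) : s ∉ strictAt W 2 (Sum.inl v₀) := by
  refine rec_of_card_two W hℓ2 hℓv hv₀ ?_ d hd hdv s hs hsv
  have h := ReductionCyclic.natCard_ker_zsmul_adicCompletion_two_pow_eq W hΔ hℓ2 hgood hℓK hℓv hidx
  rw [← zsmulAddGroupHom_natCast]
  simpa using h

/-- **Field `rec₂` at `Δ_W < 0`**: the same for a globally minimal model `Wd` of the twist `W^{(d_K)}` (`C • W.quadraticTwist d_K = Wd`),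
`K` imaginary quadratic with `d_K` odd, `ℓ ∤ d_K`; the count `#Wd(ℚ_v)[2] = 2` is route GenusKolyvaginAtTwo's
`TwinGrossPrimes.natCard_ker_zsmul_adicCompletion_two_pow_eq_twin`. [cite: McCallumLMS1991, §5 Lemma 5.3] [cite: Kolyvagin1989Izv, §3] -/
theorem rec₂_of_frobEqFrobInfty (W : WeierstrassCurve ℚ) [W.IsElliptic] [W.IsGloballyMinimal] (hΔ : W.Δ < 0)
    {K : Type} [Field K] [NumberField K] (hK : IsImaginaryQuadratic K) (hodd : Odd (NumberField.discr K))
    (Wd : WeierstrassCurve ℚ) [Wd.IsElliptic] [Wd.IsGloballyMinimal] {C : VariableChange ℚ}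
    (hC : C • W.quadraticTwist ((NumberField.discr K : ℤ) : ℚ) = Wd)
    {ℓ : ℕ} [Fact ℓ.Prime] (hℓ2 : ℓ ≠ 2) (hℓd : ¬ ((ℓ : ℤ) ∣ NumberField.discr K)) (hgood : W.HasGoodReductionAtPrime ℓ)
    (hℓK : FrobEqFrobInfty W K 2 ℓ) (hidx : 1 ≤ Zhang2014.kolyvaginIndex W 2 ℓ)
    {v v₀ : HeightOneSpectrum (𝓞 ℚ)} (hℓv : (ℓ : 𝓞 ℚ) ∈ v.asIdeal) (hv₀ : v₀ ≠ v)
    (d : galH1Torsion Wd 2) (hd : ∀ w : RatPlace, w ≠ Sum.inl v → w ≠ Sum.inl v₀ → d ∈ locAt Wd 2 w)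
    (hdv : d ∉ locAt Wd 2 (Sum.inl v)) (s : galH1Torsion Wd 2) (hs : ∀ w : RatPlace, w ≠ Sum.inl v₀ → s ∈ locAt Wd 2 w)
    (hsv : s ∉ strictAt Wd 2 (Sum.inl v)) : s ∉ strictAt Wd 2 (Sum.inl v₀) := by
  refine rec_of_card_two Wd hℓ2 hℓv hv₀ ?_ d hd hdv s hs hsv
  have h := TwinGrossPrimes.natCard_ker_zsmul_adicCompletion_two_pow_eq_twin W hK hodd hΔ Wd hC hℓ2 hℓd hgood hℓK hℓv hidx
  rw [← zsmulAddGroupHom_natCast]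
  simpa using h

end Summit.BirchSwinnertonDyer.BirchSwinnertonDyer.Theorems.RankOneAtTwoOneDoor

end
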